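import Literature.NumberTheory.EllipticCurves.XZeroFortyNineExplicit
import Literature.NumberTheory.EllipticCurves.Curve49A1Points
import HarnessLib

/-!
# Crux `MazurKenkuBound` (stmt-ABC-15125), line radius-lite: stub `stub_level49Endgame`

The Diophantine end of the level-`49` line: two DISTINCT nonzero rationals never share a value of
the level-`7` modular function `R₇(h) = (h² + 13h + 49)(h² + 5h + 1)³/h`. The plane curve
`P(s)t = P(t)s, s ≠ t` is the affine model of `X₀(49) ≅ X_sp(7)`; the tree's explicit map
`XZeroFortyNine.exists_point_rat` (`Literature/…/XZeroFortyNineExplicit.lean`, lead c23) sends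
such a point to a rational point `(x, y) ≠ (2, -1)` of `49a1 : y² + xy = x³ - x² - 2x - 1`, and
`Curve49A1.points` (`Literature/…/Curve49A1Points.lean`, rank `0` by `2`-isogeny descent, wave 1)
says the only affine rational point of `49a1` is `(2, -1)`. [cite: Ligozat1975]
[cite: Kenku1982, proof of Thm. 1, p. 200] [cite: CremonaAlgorithms1997, Table 1 (49a1)]
-/

set_option linter.dupNamespace false

noncomputable section

open scoped Classical

open Literature.NumberTheory.EllipticCurves

namespace Summit.ABC.ABC.Theorems

/-- **STUB D of the level-`49` line, proved**: two distinct nonzero rationals `s ≠ t` cannot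
satisfy `P(s)t = P(t)s`, `P(h) = (h² + 13h + 49)(h² + 5h + 1)³` — the modular curve
`X₀(49) ≅ 49a1` has only its two rational cusps (explicit isomorphism + Mordell–Weil of `49a1`).
The hypotheses `s ≠ 0`, `t ≠ 0` of the registered signature are not needed. [cite: Ligozat1975]
[cite: Kenku1982, proof of Thm. 1, p. 200] -/
theorem stub_level49Endgame :
    ∀ s t : ℚ, s ≠ t → s ≠ 0 → t ≠ 0 →
      (s ^ 2 + 13 * s + 49) * (s ^ 2 + 5 * s + 1) ^ 3 * t =
        (t ^ 2 + 13 * t + 49) * (t ^ 2 + 5 * t + 1) ^ 3 * s → False := by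
  intro s t hst _ _ h
  obtain ⟨x, y, hW, hne⟩ := XZeroFortyNine.exists_point_rat hst h
  exact hne (Curve49A1.points x y hW)

end Summit.ABC.ABC.Theorems

end
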